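import Literature.Analysis.FluidPDE.NSSereginMildFacts
import Literature.Analysis.FluidPDE.LocalLerayPressureBound
import Literature.Analysis.FluidPDE.PressureDecayEstimate
import Literature.Analysis.FluidPDE.RusinSverakSingularityStability
import Literature.Analysis.FluidPDE.NSSereginMildStabilityTools
import Literature.Analysis.FluidPDE.NSSereginMildStabilityOneScale
import HarnessLib

/-!
# Stability of a singular point at the final time, unit viscosity: the core of the reduction of
`lemarieRieusset_singular_point_stability` to Thm. 14.4, the pressure decay estimate and the
local pressure bound

Analysis/FluidPDE proof file (no new definitions, no named facts) in the decomposition of the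
named fact `Literature.Analysis.FluidPDE.lemarieRieusset_singular_point_stability`
(`NSSereginMildFacts.lean`; Lemarié-Rieusset, *The Navier–Stokes Problem in the 21st Century*,
proof of Thm. 15.5, PDF pp. 571–573 of the held scan: if local Leray solutions `v_n → v_∞` in
`L²_loc` on the slab `(0,T) × ℝ³` with uniform local-energy control and `v_∞` is bounded on a
backward cylinder `Q_{r₀}(T, x₀)`, then the `v_n` are bounded on some `Q_{r₁}(T, x₀)` for all
large `n`). This file proves the statement **at unit viscosity** from three named facts of the
tree:

* `lemarieRieusset_epsilon_regularity` — Lemarié-Rieusset 2016, **Thm. 14.4** (the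
  Caffarelli–Kohn–Nirenberg ε-regularity criterion, one-scale form), used at the final time
  through `exists_oneScale_top_of_LR` (`NSSereginMildStabilityOneScale.lean`);
* `seregin_sverak_pressure_decay` — the decay estimate for the pressure
  `D(ϱ) ≤ c[(ϱ/r) D(r) + (r/ϱ)² C(r)]` (Seregin–Šverák 2009, (as13); `PressureDecayEstimate.lean`),
  which packages the printed pressure split `p = ϖ + p₁ + p₂,R + p₃,R` of pp. 571–572
  (Calderón–Zygmund part + harmonic part) in scale-invariant form, exactly as in the tree's proof
  of Rusin–Šverák's Lemma 2.1 (`RusinSverakSingularityStability.lean`);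
* `kangMiuraTsai_local_pressure_bound` — the local `L^{3/2}` bound for the gauged pressure of a
  slab local Leray solution in terms of its uniformly local energy (Kang–Miura–Tsai 2021,
  Lemma 3.4 and its proof; `LocalLerayPressureBound.lean`), which supplies the bound, uniform in
  `n`, on the pressure quantity `D_n(r)` at the starting scale (for Lemarié-Rieusset's own class
  this is the pressure formula of Def. 6.13/14.1 with (14.9)).

**The argument** (`singular_point_stability_unit`; Lemarié-Rieusset pp. 571–573 in the
Rusin–Šverák / Seregin packaging, at the *top* time `T`, where only backward cylinders enter —
simpler than the interior Lemma 2.1, no shifted centres). Let `|v_∞| ≤ M` a.e. on `Q_{r₀}(T,x₀)`,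
`ρ = min(r₀, 1)`. (i) Gauges: by the pressure bound, `π_n - c_n(t)` has
`∫₀ᵀ∫_{B₁(x₀)} |π_n - c_n|^{3/2} ≤ K` uniformly in `n` (the datum hypotheses of the fact follow from
the solution clauses: `IsLocalLeraySolutionOn.lintegral_ball_datum_le`,
`IsLocalLeraySolutionOn.isWeaklyDivFree_datum`), and `(v_n, π_n - c_n)` is again a suitable weak
solution on the slab (`IsSuitableWeakSolutionOn.sub_timeGauge_slab`). (ii) Cubic terms: `v_n → v_∞`
in `L³(Q_ρ(T,x₀))` (`tendsto_lintegral_cube_parabolicCylinder`: uniform `L^{10/3}` bounds and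
interpolation), so `C_n(s) ≤ 4|B₁|M³s³ + 4s⁻²∫∫_{Q_ρ}|v_n - v_∞|³` is small at all scales
`s = θʲ r`, `j ≤ J`, for `r` small and `n` large (`cknC_le_of_ae_bound_of_lintegral_sub`).
(iii) Pressure: the decay estimate iterated `J` times (`cknD_iterate_le_of_pressure_decay`, the
cylinders `Q_r(T,x₀) ⊆ (0,T) × ℝ³` needing only the open inclusion) gives
`D_n(θᴶ r) ≤ 2^{-J} r⁻² K + 2cθ⁻² max_j C_n(θʲ r)`. Choosing `r`, then `J`, then `n`,
`C_n(s) + D_n(s) ≤ ε₀³` at `s = θᴶ r`, and Thm. 14.4 on `Ω = Q_s(T, x₀)` bounds `v_n` on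
`Q_{s/2}(T, x₀)` ("By Theorem 14.4, we conclude that `v_{n_k}` is bounded on `Q_{r₁/2}`", p. 573).

The general-viscosity statement `lemarieRieusset_singular_point_stability` follows by the time
rescaling `v ↦ ν⁻¹ v(·/ν, ·)` (`NSSereginMildStability.lean`).

## References

* P. G. Lemarié-Rieusset, *The Navier–Stokes Problem in the 21st Century* (2016; held scan =
  2nd ed., doi:10.1201/9781003042594): proof of Thm. 15.5, PDF pp. 570–573; Thm. 14.4 (p. 505).
* W. Rusin, V. Šverák, J. Funct. Anal. 260 (2011) = arXiv:0911.0500, Lemma 2.1 and its proof.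
* G. Seregin, V. Šverák, Comm. PDE 34 (2009) = arXiv:0804.1803, (as13).
* K. Kang, H. Miura, T.-P. Tsai, IMRN 2021 = arXiv:1812.10509, Lemma 3.4.
-/

noncomputable section

open MeasureTheory TopologicalSpace Set Function Filter Metric Module
open _root_.Topology
open scoped ENNReal NNReal RealInnerProductSpace

namespace Literature.Analysis.FluidPDE

/-- **Stability of a singular point at the final time, unit viscosity** (Lemarié-Rieusset 2016,
proof of Thm. 15.5, PDF pp. 571–573, the statement of `lemarieRieusset_singular_point_stability`
at `ν = 1`), from Thm. 14.4 (`lemarieRieusset_epsilon_regularity`), the pressure decay estimate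
(`seregin_sverak_pressure_decay`) and the local pressure bound
(`kangMiuraTsai_local_pressure_bound`). Proof: module docstring, steps (i)–(iii).
[cite: LemarieRieusset2016, proof of Thm. 15.5, PDF pp. 571–573 (15.5)–(15.6) with Thm. 14.4] -/
theorem singular_point_stability_unit (hε : lemarieRieusset_epsilon_regularity)
    (hPD : seregin_sverak_pressure_decay) (hKP : kangMiuraTsai_local_pressure_bound)
    {T : ℝ} (hT : 0 < T) (C : ℝ≥0)
    (a : ℕ → EuclideanSpace ℝ (Fin 3) → EuclideanSpace ℝ (Fin 3))
    (v : ℕ → ℝ → EuclideanSpace ℝ (Fin 3) → EuclideanSpace ℝ (Fin 3))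
    (π : ℕ → ℝ → EuclideanSpace ℝ (Fin 3) → ℝ)
    (aL : EuclideanSpace ℝ (Fin 3) → EuclideanSpace ℝ (Fin 3))
    (vL : ℝ → EuclideanSpace ℝ (Fin 3) → EuclideanSpace ℝ (Fin 3))
    (πL : ℝ → EuclideanSpace ℝ (Fin 3) → ℝ)
    (hv : ∀ n, IsLocalLeraySolutionOn T 1 (a n) (v n) (π n))
    (hvL : IsLocalLeraySolutionOn T 1 aL vL πL)
    (hC : ∀ n, ∀ᵐ t ∂(volume.restrict (Ioo 0 T)), ∀ x₀ : EuclideanSpace ℝ (Fin 3),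
      ∫⁻ x in ball x₀ 1, ‖v n t x‖ₑ ^ 2 ≤ C)
    (hG : ∀ n, ∃ G : ℝ → EuclideanSpace ℝ (Fin 3) →
        EuclideanSpace ℝ (Fin 3) →L[ℝ] EuclideanSpace ℝ (Fin 3),
      HasWeakSpatialGradientOn (slab (EuclideanSpace ℝ (Fin 3)) (Ioo 0 T) isOpen_Ioo) (v n) G ∧
        ∀ x₀ : EuclideanSpace ℝ (Fin 3), ∫⁻ z in Ioo 0 T ×ˢ ball x₀ 1,
          ENNReal.ofReal (frobeniusNormSq (G z.1 z.2)) ≤ C)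
    (hconv : ∀ R : ℝ, 0 < R →
      Tendsto (fun n => ∫⁻ z in Ioo 0 T ×ˢ ball (0 : EuclideanSpace ℝ (Fin 3)) R,
        ‖v n z.1 z.2 - vL z.1 z.2‖ₑ ^ 2) atTop (𝓝 0))
    (x₀ : EuclideanSpace ℝ (Fin 3))
    (hreg : ∃ r₀ : ℝ, 0 < r₀ ∧ r₀ ^ 2 < T ∧
      eLpNorm (uncurry vL) ∞ (volume.restrict (parabolicCylinder r₀ ((T : ℝ), x₀))) < ∞) :
    ∃ r₁ : ℝ, 0 < r₁ ∧ ∀ᶠ n in atTop,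
      eLpNorm (uncurry (v n)) ∞ (volume.restrict (parabolicCylinder r₁ ((T : ℝ), x₀))) < ∞ := by
  obtain ⟨r₀, hr₀, hr₀T, hbdd⟩ := hreg
  set z : ℝ × EuclideanSpace ℝ (Fin 3) := ((T : ℝ), x₀) with hz
  -- constants of the three facts
  obtain ⟨ε₀, hε₀, hOS⟩ := exists_oneScale_top_of_LR hε
  obtain ⟨c, hPDr⟩ := hPD.ratio
  obtain ⟨θ, hθ, hθhalf, hcθ⟩ := exists_ratio_mul_le_half c
  have hθ1 : θ ≤ 1 := hθhalf.trans (by norm_num)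
  -- (i) gauges with a uniform pressure bound
  obtain ⟨KP, hKPT⟩ := hKP T 1 (2 * C) hT one_pos
  have hC2 : (C : ℝ≥0∞) ≤ ((2 * C : ℝ≥0) : ℝ≥0∞) := by
    push_cast
    exact le_mul_of_one_le_left bot_le one_le_two
  have hgauge : ∀ n, ∃ cg : ℝ → ℝ, MemLp cg (3 / 2 : ℝ≥0∞) (volume.restrict (Ioo 0 T)) ∧
      ∫⁻ w in Ioo 0 T ×ˢ ball x₀ 1, ‖π n w.1 w.2 - cg w.1‖ₑ ^ (3 / 2 : ℝ) ≤ KP := by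
    intro n
    refine hKPT (a n) (v n) (π n) (hv n) (fun x₁ => ?_) ((hv n).isWeaklyDivFree_datum hT) ?_ ?_ x₀
    · have h1 := (hv n).lintegral_ball_datum_le hT (hC n) x₁
      refine h1.trans (le_of_eq ?_)
      push_cast
      ring
    · filter_upwards [hC n] with t ht x₁
      exact (ht x₁).trans hC2
    · obtain ⟨G, hGn, hGb⟩ := hG n
      exact ⟨G, hGn, fun x₁ => (hGb x₁).trans hC2⟩
  choose cg hcg hcgb using hgauge
  set p : ℕ → ℝ → EuclideanSpace ℝ (Fin 3) → ℝ := fun n t x => π n t x - cg n t with hp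
  have hgs : ∀ n, IsSuitableWeakSolutionOn (slab (EuclideanSpace ℝ (Fin 3)) (Ioo 0 T) isOpen_Ioo)
      1 0 (v n) (p n) := fun n => (hv n).suitable.sub_timeGauge_slab (hcg n)
  -- the essential bound of the limit on `Q_{r₀}(z)`
  set M : ℝ≥0∞ := eLpNorm (uncurry vL) ∞ (volume.restrict (parabolicCylinder r₀ z)) with hMdef
  have hM : ∀ᵐ w ∂(volume.restrict (parabolicCylinder r₀ z)), ‖vL w.1 w.2‖ₑ ≤ M :=
    ae_enorm_le_eLpNorm_top vL _
  have hMtop : M ≠ ∞ := hbdd.ne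
  -- (ii) the radius `ρ` and the `L³` convergence on `Q_ρ(z)`
  set ρ : ℝ := min r₀ 1 with hρdef
  have hρ : 0 < ρ := lt_min hr₀ one_pos
  have hρ1 : ρ ≤ 1 := min_le_right _ _
  have hρr₀ : ρ ≤ r₀ := min_le_left _ _
  have hρT : ρ ^ 2 ≤ T := (pow_le_pow_left₀ hρ.le hρr₀ 2).trans hr₀T.le
  obtain ⟨CL, hCL⟩ := hvL.uniformLocalEnergy 1 one_pos
  obtain ⟨GLim, hGLim, hGLimb⟩ := hvL.uniformLocalGradient
  obtain ⟨CL', hCL'⟩ := hGLimb 1 one_pos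
  set C' : ℝ≥0∞ := (C : ℝ≥0∞) + CL + CL' with hC'
  have hC'top : C' ≠ ∞ := by simp [hC']
  have hCC' : (C : ℝ≥0∞) ≤ C' := by rw [hC', add_assoc]; exact le_self_add
  have hCLC' : (CL : ℝ≥0∞) ≤ C' := by
    rw [hC']; exact le_add_self.trans le_self_add
  have hCL'C' : (CL' : ℝ≥0∞) ≤ C' := by rw [hC']; exact le_add_self
  have hconv1 : Tendsto (fun n => ∫⁻ w in Ioo 0 T ×ˢ ball x₀ 1,
      ‖v n w.1 w.2 - vL w.1 w.2‖ₑ ^ 2) atTop (𝓝 0) := by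
    have hsub : Ioo (0 : ℝ) T ×ˢ ball x₀ 1 ⊆
        Ioo (0 : ℝ) T ×ˢ ball (0 : EuclideanSpace ℝ (Fin 3)) (‖x₀‖ + 1) := by
      refine prod_mono Subset.rfl fun y hy => ?_
      rw [mem_ball, dist_zero_right]
      rw [mem_ball, dist_eq_norm] at hy
      linarith [norm_sub_norm_le y x₀]
    exact tendsto_of_tendsto_of_tendsto_of_le_of_le tendsto_const_nhds
      (hconv (‖x₀‖ + 1) (by positivity)) (fun _ => bot_le) fun n => lintegral_mono_set hsub
  have hδ : Tendsto (fun n => ∫⁻ w in parabolicCylinder ρ z,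
      ‖v n w.1 w.2 - vL w.1 w.2‖ₑ ^ (3 : ℕ)) atTop (𝓝 0) := by
    refine tendsto_lintegral_cube_parabolicCylinder hρ hρ1 hρT hC'top
      (fun n => (hv n).aestronglyMeasurable) hvL.aestronglyMeasurable (fun n => ?_) (fun n => ?_)
      ?_ ?_ hconv1
    · filter_upwards [hC n] with t ht x₁
      exact (ht x₁).trans hCC'
    · obtain ⟨G, hGn, hGb⟩ := hG n
      exact ⟨G, hGn, (hGb x₀).trans hCC'⟩
    · filter_upwards [hCL] with t ht x₁
      exact (ht x₁).trans hCLC'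
    · exact ⟨GLim, hGLim, (hCL' x₀).trans hCL'C'⟩
  -- constants
  set V₁ : ℝ≥0∞ := volume (ball (0 : EuclideanSpace ℝ (Fin 3)) 1) with hV₁
  have hV₁top : V₁ ≠ ∞ := measure_ball_lt_top.ne
  set Θ : ℝ≥0∞ := ENNReal.ofReal ((θ⁻¹) ^ 2) with hΘ
  set L : ℝ≥0∞ := 1 + 2 * ((c : ℝ≥0∞) * Θ) with hL
  have hLtop : L ≠ ∞ := ENNReal.add_ne_top.2 ⟨ENNReal.one_ne_top, ENNReal.mul_ne_top
    ENNReal.ofNat_ne_top (ENNReal.mul_ne_top ENNReal.coe_ne_top ENNReal.ofReal_ne_top)⟩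
  set ε : ℝ≥0∞ := ENNReal.ofReal (ε₀ ^ 3) with hεdef
  have hε4 : 0 < ε / 4 :=
    ENNReal.div_pos (ENNReal.ofReal_pos.2 (by positivity)).ne' ENNReal.ofNat_ne_top
  -- (A) the starting radius `rB ≤ ρ`: `L · 4 |B₁| M³ rB³ ≤ ε/4`
  obtain ⟨rA, hrA, hA⟩ := exists_forall_ofReal_pow_three_mul_le (N := L * (4 * (V₁ * M ^ 3)))
    (ENNReal.mul_ne_top hLtop (ENNReal.mul_ne_top ENNReal.ofNat_ne_top
      (ENNReal.mul_ne_top hV₁top (ENNReal.pow_ne_top hMtop)))) hε4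
  set rB : ℝ := min ρ rA with hrBdef
  have hrB : 0 < rB := lt_min hρ hrA
  have hrBρ : rB ≤ ρ := min_le_left _ _
  have hrB1 : rB ≤ 1 := hrBρ.trans hρ1
  have hrBr₀ : rB ≤ r₀ := hrBρ.trans hρr₀
  have hrBT : rB ^ 2 ≤ T := (pow_le_pow_left₀ hrB.le hrBρ 2).trans hρT
  have hArB : ENNReal.ofReal (rB ^ 3) * (L * (4 * (V₁ * M ^ 3))) ≤ ε / 4 :=
    hA rB hrB (min_le_right _ _)
  -- (B) the number of steps `J`
  set P : ℝ≥0∞ := (ENNReal.ofReal rB ^ 2)⁻¹ * KP with hPdef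
  have hPtop : P ≠ ∞ :=
    ENNReal.mul_ne_top (ENNReal.inv_ne_top.2 (pow_ne_zero 2 (ENNReal.ofReal_pos.2 hrB).ne'))
      ENNReal.coe_ne_top
  obtain ⟨J, hJ⟩ := exists_inv_two_pow_mul_le hPtop hε4
  -- the final scale `s = θᴶ rB`
  set s : ℝ := θ ^ J * rB with hsdef
  have hs : 0 < s := by positivity
  have hsrB : s ≤ rB := mul_le_of_le_one_left hrB.le (pow_le_one₀ hθ.le hθ1)
  have hs1 : s ≤ 1 := hsrB.trans hrB1
  have hsT : s ^ 2 ≤ T := (pow_le_pow_left₀ hs.le hsrB 2).trans hrBT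
  have hscale0 : ∀ j : ℕ, 0 < θ ^ j * rB := fun j => by positivity
  have hscale1 : ∀ j : ℕ, θ ^ j * rB ≤ rB := fun j =>
    mul_le_of_le_one_left hrB.le (pow_le_one₀ hθ.le hθ1)
  have hscale2 : ∀ j ≤ J, s ≤ θ ^ j * rB := fun j hj =>
    mul_le_mul_of_nonneg_right (pow_le_pow_of_le_one hθ.le hθ1 hj) hrB.le
  -- (C) large `n`: the `L³` error is small at the scale `s`
  have hevT : ∀ᶠ n : ℕ in atTop, L * (4 * ((ENNReal.ofReal s ^ 2)⁻¹ *
      ∫⁻ w in parabolicCylinder ρ z, ‖v n w.1 w.2 - vL w.1 w.2‖ₑ ^ (3 : ℕ))) ≤ ε / 4 := by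
    have hfin : L * (4 * (ENNReal.ofReal s ^ 2)⁻¹) ≠ ∞ :=
      ENNReal.mul_ne_top hLtop (ENNReal.mul_ne_top ENNReal.ofNat_ne_top
        (ENNReal.inv_ne_top.2 (pow_ne_zero 2 (ENNReal.ofReal_pos.2 hs).ne')))
    have h1 := ENNReal.Tendsto.const_mul hδ (Or.inr hfin)
    rw [mul_zero] at h1
    have h2 : Tendsto (fun n : ℕ => L * (4 * ((ENNReal.ofReal s ^ 2)⁻¹ *
        ∫⁻ w in parabolicCylinder ρ z, ‖v n w.1 w.2 - vL w.1 w.2‖ₑ ^ (3 : ℕ)))) atTop (𝓝 0) := by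
      refine h1.congr fun n => ?_
      simp only [mul_assoc]
    exact h2.eventually (ge_mem_nhds hε4)
  refine ⟨s / 2, by positivity, ?_⟩
  filter_upwards [hevT] with n hnT
  -- the cubic inputs of the approximant `v n`
  set Tn : ℝ≥0∞ := ∫⁻ w in parabolicCylinder ρ z, ‖v n w.1 w.2 - vL w.1 w.2‖ₑ ^ (3 : ℕ) with hTn
  set e : ℝ≥0∞ := 4 * (V₁ * M ^ 3 * ENNReal.ofReal (rB ^ 3)) + 4 * ((ENNReal.ofReal s ^ 2)⁻¹ * Tn)
    with hedef
  have hCe : ∀ j ≤ J, cknC (θ ^ j * rB) z (v n) ≤ e := by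
    intro j hj
    have hQS : parabolicCylinder (θ ^ j * rB) z ⊆ parabolicCylinder r₀ z :=
      parabolicCylinder_mono (hscale0 j).le ((hscale1 j).trans hrBr₀) z
    have hQK : parabolicCylinder (θ ^ j * rB) z ⊆ parabolicCylinder ρ z :=
      parabolicCylinder_mono (hscale0 j).le ((hscale1 j).trans hrBρ) z
    refine (cknC_le_of_ae_bound_of_lintegral_sub (hscale0 j) hQS hQK hM le_rfl).trans ?_
    have h1 : ENNReal.ofReal ((θ ^ j * rB) ^ 3) ≤ ENNReal.ofReal (rB ^ 3) :=
      ENNReal.ofReal_le_ofReal (pow_le_pow_left₀ (hscale0 j).le (hscale1 j) 3)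
    have h2 : (ENNReal.ofReal (θ ^ j * rB) ^ 2)⁻¹ ≤ (ENNReal.ofReal s ^ 2)⁻¹ :=
      ENNReal.inv_le_inv.2 (pow_le_pow_left' (ENNReal.ofReal_le_ofReal (hscale2 j hj)) 2)
    rw [hedef]
    gcongr
  -- (iii) the pressure of the approximant at the last scale
  have hsubQ : parabolicCylinder rB z ⊆
      ((slab (EuclideanSpace ℝ (Fin 3)) (Ioo 0 T) isOpen_Ioo : Opens (ℝ × EuclideanSpace ℝ (Fin 3)))
        : Set (ℝ × EuclideanSpace ℝ (Fin 3))) := parabolicCylinder_top_subset_slab hrBT x₀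
  have hD : cknD s z (p n) ≤
      (2⁻¹ : ℝ≥0∞) ^ J * cknD rB z (p n) + 2 * ((c : ℝ≥0∞) * Θ * e) :=
    cknD_iterate_le_of_pressure_decay hPDr hθ hθ1 hcθ (hgs n).distributional hrB hsubQ
      (fun j hj => hCe j hj.le)
  have hD0 : cknD rB z (p n) ≤ P :=
    (cknD_le_of_subset (p n) (parabolicCylinder_top_subset_box hrB1 hrBT x₀)).trans
      (mul_le_mul' le_rfl (hcgb n))
  -- smallness `C + D ≤ ε` at the scale `s`
  have hsmall : cknC s z (v n) + cknD s z (p n) ≤ ε := by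
    have h1 : cknC s z (v n) ≤ e := hCe J le_rfl
    have h2 : L * e ≤ ε / 4 + ε / 4 := by
      rw [hedef, mul_add]
      refine add_le_add ?_ hnT
      calc L * (4 * (V₁ * M ^ 3 * ENNReal.ofReal (rB ^ 3)))
          = ENNReal.ofReal (rB ^ 3) * (L * (4 * (V₁ * M ^ 3))) := by ring
        _ ≤ ε / 4 := hArB
    have h3 : (2⁻¹ : ℝ≥0∞) ^ J * cknD rB z (p n) ≤ ε / 4 := le_trans (by gcongr) hJ
    calc cknC s z (v n) + cknD s z (p n)
        ≤ e + ((2⁻¹ : ℝ≥0∞) ^ J * cknD rB z (p n) + 2 * ((c : ℝ≥0∞) * Θ * e)) :=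
          add_le_add h1 hD
      _ = L * e + (2⁻¹ : ℝ≥0∞) ^ J * cknD rB z (p n) := by rw [hL]; ring
      _ ≤ (ε / 4 + ε / 4) + ε / 4 := add_le_add h2 h3
      _ ≤ ε := ENNReal.add_quarters_le ε
  -- Thm. 14.4 on `Ω = Q_s(T, x₀)`
  obtain ⟨G, hGn, hGb⟩ := hG n
  exact hOS T x₀ s (v n) (p n) C hs hs1 hsT (hgs n) (hC n)
    ⟨G, hGn, (hGb x₀).trans_lt ENNReal.coe_lt_top⟩ ((hcgb n).trans_lt ENNReal.coe_lt_top) hsmall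

end Literature.Analysis.FluidPDE

end
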